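import Literature.Analysis.Distribution.LaplaceTestTransform
import Literature.MathematicalPhysics.QuantumFieldTheory.WightmanProofs
import Literature.MathematicalPhysics.QuantumLattice.WightmanTubeLaplace
import Literature.Analysis.FunctionSpaces.WightmanGNSSpectral
import HarnessLib

/-!
# Momentum-space geometry of the Osterwalder–Schrader Laplace transform

Topic `Literature/MathematicalPhysics/QuantumFieldTheory`; geometric bookkeeping for the proof of
`OS1973_wightmanVectors` (`OSWightmanVectors`) along Osterwalder–Schrader I (1973), §4.3: the
Fourier–Laplace transform `f ↦ f̃` (4.19)–(4.20) of Euclidean test functions, i.e. the tree's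
generic `Literature.Analysis.Distribution.laplaceTest` (`LaplaceTestTransform`) at the
**Euclidean points** `(i x⁰ₖ, x⃗ₖ)ₖ` of a configuration `x ∈ (ℝ^{d+1})ⁿ`:

* `euclidUncurry d n : (ℝ^{d+1})ⁿ →L[ℝ] ℂ^{n(d+1)}`, `x ↦ configUncurry (euclideanPoint x)`, with
  `Im (euclidUncurry x) = flatten ((x⁰ₖ e₀)ₖ)` (`imVec_euclidUncurry`);
* the sets of momenta met in OS I §4.3: the spectral set `spectralSet d n` of the tree
  (`∑ pⱼ = 0`, partial sums in `V̄₊`, the support of `W̃ₙ`) and the **OS momentum set**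
  `osMomentumSet d m = {q | ∃ p ∈ spectralSet d (m+1), q = tail p}` = `{q | all tail sums
  ∑_{j ≥ i} qⱼ ∈ V̄₋}` (the momenta `q_k, k ≥ 0`, of (4.20), the set `{q⁰ₖ ≥ 0}` of OS in the
  tree's sign convention), the momenta carried by a block of positive-time points;
* the **admissible Euclidean configurations**: configurations with strictly increasing times of
  any sign have `Im` in the relative-tube cone, hence lie in the Laplace domain of the spectral set
  (`monoRegion_subset_laplaceDomain`); positive-time ordered configurations (`timeOrderedRegion`)
  lie in the Laplace domain of the OS momentum set (`timeOrderedRegion_subset_laplaceDomain_os`,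
  through the polar-cone inequality `inner_sum_nonpos_of_mem_spectralSet` of the tree applied to
  `(0, η)` and a lift `p` of `q`);
* the **block structure** of the spectral set of `n + m` points: the last `m` momenta lie in
  `osMomentumSet d m` (`block_natAdd_mem_osMomentumSet`), the first `n`, reversed and negated, lie
  in `osMomentumSet d n` (`negRev_block_castAdd_mem_osMomentumSet`) — the two ways a block of an OS
  inner product `𝔖ₙ₊ₘ(Θf* ⊗ g)` sees the spectrum (OS I (4.24): `f̄̃ₙ(qₙ, −q_{n−1}, …, −q₁)` and
  `g̃ₘ(qₙ, …, q_{n+m−1})`), and `spectralSet d m ⊆ osMomentumSet d m`;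
* the **exponent** `expForm (euclidUncurry x) (flatten ξ) = 2π ∑ₖ x⁰ₖ ξ⁰ₖ − 2πi ∑ₖ ⟪x⃗ₖ, ξ⃗ₖ⟫`
  of the Laplace kernel at Euclidean points and its behaviour under appending blocks, under the
  OS reflection `x ↦ (θx_{n−1}, …, θx₀)` (complex conjugation composed with `ξ ↦ (−ξ_{n−1}, …, −ξ₀)`,
  `negRevConfig`) and under translations (a spatial translation gives the Fourier phase
  `−2πi⟪ã, ξ̃⟫`, a time translation the real factor `2πt ∑ₖ ξ⁰ₖ`).

## References

* K. Osterwalder, R. Schrader, *Axioms for Euclidean Green's functions*, Comm. Math. Phys. 31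
  (1973) 83–112, §4.1 (4.12), §4.3 (4.19)–(4.20), (4.23)–(4.24). [OsterwalderSchraderCMP1973]
* R. F. Streater, A. S. Wightman, *PCT, Spin and Statistics, and All That* (1964), §3-3
  eq. (3-13) (the spectral set). [StreaterWightman1964]
-/

noncomputable section

open Set Filter Complex MeasureTheory
open _root_.Topology
open scoped SchwartzMap RealInnerProductSpace ComplexConjugate
open Literature.MathematicalPhysics.QuantumLattice Literature.MathematicalPhysics.QuantumFieldTheory
open Literature.Analysis.FunctionSpaces Literature.Analysis.Distribution

namespace Literature.MathematicalPhysics.QuantumFieldTheory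

variable {d n m : ℕ}

/-! ### The Euclidean points as a real-linear map into `ℂ^{n(d+1)}` -/

variable (d n) in
/-- **The Euclidean embedding** `x ↦ ((i x⁰ₖ, x⃗ₖ))ₖ`, uncurried to `ℂ^{n(d+1)}`:
`euclidUncurry d n x (k, μ) = euclideanPoint x k μ` (OS I (1973), (4.12), the Euclidean points
`(i ξ⁰, ξ⃗)`), as a continuous `ℝ`-linear map (the argument of the Fourier–Laplace kernel).
[cite: OsterwalderSchraderCMP1973, §4.1 eq. (4.12)] -/
def euclidUncurry : (Fin n → SpaceTime d) →L[ℝ] (Fin n × Fin (d + 1) → ℂ) :=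
  LinearMap.toContinuousLinearMap
    { toFun := fun x => configUncurry d n (euclideanPoint x)
      map_add' := fun x y => by
        funext p
        rcases p with ⟨k, μ⟩
        by_cases hμ : μ = 0
        · subst hμ; simp [configUncurry, euclideanPoint]; ring
        · simp [configUncurry, euclideanPoint, hμ]
      map_smul' := fun c x => by
        funext p
        rcases p with ⟨k, μ⟩
        by_cases hμ : μ = 0
        · subst hμ; simp [configUncurry, euclideanPoint]; ring
        · simp [configUncurry, euclideanPoint, hμ] }

/-- Pointwise formula. [folklore] -/
@[simp]
theorem euclidUncurry_apply (x : Fin n → SpaceTime d) (p : Fin n × Fin (d + 1)) :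
    euclidUncurry d n x p = euclideanPoint x p.1 p.2 := rfl

/-- `euclidUncurry = configUncurry ∘ euclideanPoint`. [folklore] -/
theorem euclidUncurry_eq (x : Fin n → SpaceTime d) :
    euclidUncurry d n x = configUncurry d n (euclideanPoint x) := rfl

/-- **The imaginary part of a Euclidean point** is the flattened configuration of Euclidean times
along `e₀`: `Im (euclidUncurry x) = flatten ((x⁰ₖ e₀)ₖ)`. [folklore] -/
theorem imVec_euclidUncurry (x : Fin n → SpaceTime d) :
    imVec (euclidUncurry d n x) = flattenCLE d n fun k => (x k 0) • e₀ d := by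
  rw [euclidUncurry_eq, show imVec (configUncurry d n (euclideanPoint x)) =
    (WithLp.toLp 2 fun i => (configUncurry d n (euclideanPoint x) i).im) from rfl,
    toLp_im_configUncurry]
  congr 1
  funext k
  exact imPart_euclideanPoint x k

/-! ### Admissible Euclidean configurations -/

variable (d n) in
/-- Configurations with strictly increasing Euclidean times (of any sign). [folklore] -/
def monoRegion : Set (Fin n → SpaceTime d) := {x | StrictMono fun k => x k 0}

/-- The positive time-ordered region lies in the monotone region. [folklore] -/
theorem timeOrderedRegion_subset_monoRegion : timeOrderedRegion d n ⊆ monoRegion d n :=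
  fun _ hx => hx.2

/-- The monotone region is open. [folklore] -/
theorem isOpen_monoRegion : IsOpen (monoRegion d n) := by
  have h : monoRegion d n = ⋂ i : Fin n, ⋂ j : Fin n, {x | i < j → x i 0 < x j 0} := by
    ext x
    simp only [monoRegion, mem_setOf_eq, mem_iInter, StrictMono]
  rw [h]
  refine isOpen_iInter_of_finite fun i => isOpen_iInter_of_finite fun j => ?_
  by_cases hij : i < j
  · have hc : ∀ k : Fin n, Continuous fun x : Fin n → SpaceTime d => x k 0 := fun k =>
      (EuclideanSpace.proj (0 : Fin (d + 1))).continuous.comp (continuous_apply k)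
    simpa [hij] using isOpen_lt (hc i) (hc j)
  · simp [hij]

/-- For increasing times, the Euclidean time directions `(x⁰ₖ e₀)ₖ` lie in the cone of the
relative tube (no condition on the first time). [folklore] -/
theorem smul_e₀_mem_relTubeCone {x : Fin n → SpaceTime d} (hx : x ∈ monoRegion d n) :
    (fun k => (x k 0) • e₀ d) ∈ relTubeCone d n := by
  intro k hk
  rw [succDiff_map (fun t : ℝ => t • e₀ d) (fun a b => sub_smul a b _), smul_e₀_mem_forwardCone_iff]
  cases n with
  | zero => exact k.elim0
  | succ n =>
    have hk0 : k ≠ 0 := fun h0 => by simp [h0] at hk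
    obtain ⟨j, rfl⟩ := Fin.exists_succ_eq.2 hk0
    rw [succDiff_succ]
    exact sub_pos.2 (hx (Fin.castSucc_lt_succ (i := j)))

/-- For positive increasing times, `(x⁰ₖ e₀)ₖ` lies in the base cone of the forward tube.
[folklore] -/
theorem smul_e₀_mem_tubeCone {x : Fin n → SpaceTime d} (hx : x ∈ timeOrderedRegion d n) :
    (fun k => (x k 0) • e₀ d) ∈ tubeCone d n := by
  have h := euclideanPoint_mem_forwardTube hx.1 hx.2
  rw [mem_forwardTube_iff_imPart_mem_tubeCone] at h
  simpa only [imPart_euclideanPoint] using h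

/-- **Increasing-time configurations are admissible for the spectral set**: their Euclidean points
lie in the Laplace domain of `flatten '' spectralSet d n` (the relative-tube cone is in the interior
of its polar cone, `flattenCLE_mem_interior_polarCone`). [folklore] -/
theorem monoRegion_subset_laplaceDomain :
    monoRegion d n ⊆ laplaceDomain (flattenCLE d n '' spectralSet d n) (euclidUncurry d n) := by
  intro x hx
  rw [mem_laplaceDomain_iff, imVec_euclidUncurry]
  exact flattenCLE_mem_interior_polarCone (smul_e₀_mem_relTubeCone hx)

/-! ### The OS momentum set -/

variable (d m) in
/-- **The OS momentum set** of a block of `m` positive-time points: the momenta `q ∈ (ℝ^{1+d})ᵐ`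
which are the last `m` momenta of a point `(p₀, q)` of the spectral set of `m + 1` points;
equivalently all tail sums `∑_{j ≥ i} qⱼ` lie in `V̄₋` (Osterwalder–Schrader I (1973), (4.20):
the variables `q_k` of `f̃`, restricted to `{q⁰ₖ ≥ 0}` in OS's sign convention).
[cite: OsterwalderSchraderCMP1973, §4.3 eq. (4.20)] -/
def osMomentumSet : Set (Fin m → SpaceTime d) :=
  {q | ∃ p ∈ spectralSet d (m + 1), q = fun i => p i.succ}

/-- `Fin.cons 0 η` of a point of the base cone of `𝒯ₘ` lies in the relative-tube cone of `m + 1`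
points. [folklore] -/
theorem cons_zero_mem_relTubeCone {η : Fin m → SpaceTime d} (hη : η ∈ tubeCone d m) :
    (Fin.cons 0 η : Fin (m + 1) → SpaceTime d) ∈ relTubeCone d (m + 1) := by
  rw [mem_relTubeCone_succ_iff]
  intro j
  cases m with
  | zero => exact j.elim0
  | succ m =>
    refine Fin.cases ?_ (fun i => ?_) j
    · have h0 := hη 0
      rw [succDiff_zero] at h0
      have e : (Fin.cons 0 η : Fin (m + 2) → SpaceTime d) (Fin.succ 0) -
          (Fin.cons 0 η : Fin (m + 2) → SpaceTime d) (Fin.castSucc 0) = η 0 := by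
        rw [Fin.castSucc_zero, Fin.cons_zero, Fin.cons_succ, sub_zero]
      rw [e]; exact h0
    · have h' := hη i.succ
      rw [succDiff_succ] at h'
      have e : (Fin.cons 0 η : Fin (m + 2) → SpaceTime d) i.succ.succ -
          (Fin.cons 0 η : Fin (m + 2) → SpaceTime d) (Fin.castSucc i.succ) = η i.succ - η i.castSucc := by
        rw [← Fin.succ_castSucc, Fin.cons_succ, Fin.cons_succ]
      rw [e]; exact h'

/-- **The polar-cone inequality for the OS momentum set**: `∑ₖ ⟪ηₖ, qₖ⟫ ≤ 0` for `η` in the base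
cone of `𝒯ₘ` and `q ∈ osMomentumSet d m` (lift `q` to the spectral set of `m + 1` points and `η`
to `(0, η)`, then `inner_sum_nonpos_of_mem_spectralSet`). [folklore] -/
theorem inner_sum_nonpos_of_mem_osMomentumSet {η q : Fin m → SpaceTime d} (hη : η ∈ tubeCone d m)
    (hq : q ∈ osMomentumSet d m) : ∑ k, ⟪η k, q k⟫ ≤ 0 := by
  obtain ⟨p, hp, rfl⟩ := hq
  have h := inner_sum_nonpos_of_mem_spectralSet (cons_zero_mem_relTubeCone hη) hp
  rw [Fin.sum_univ_succ] at h
  simpa using h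

/-- **The base cone of `𝒯ₘ` lies in the interior of the polar cone of the OS momentum set** (after
flattening). [folklore] -/
theorem flattenCLE_mem_interior_polarCone_osMomentumSet {η : Fin m → SpaceTime d}
    (hη : η ∈ tubeCone d m) :
    flattenCLE d m η ∈ interior (polarCone (flattenCLE d m '' osMomentumSet d m)) := by
  have hsub : flattenCLE d m '' tubeCone d m ⊆ polarCone (flattenCLE d m '' osMomentumSet d m) := by
    rintro _ ⟨η', hη', rfl⟩
    rw [mem_polarCone_iff]
    rintro _ ⟨q, hq, rfl⟩
    rw [inner_flattenCLE]
    exact inner_sum_nonpos_of_mem_osMomentumSet hη' hq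
  have htc : tubeCone d m = ⋂ k : Fin m, (fun η : Fin m → SpaceTime d => succDiff η k) ⁻¹' forwardCone d := by
    ext η; simp [tubeCone]
  have hopen : IsOpen (flattenCLE d m '' tubeCone d m) := by
    refine (flattenCLE d m).toHomeomorph.isOpenMap _ ?_
    have hs : ∀ k : Fin m, Continuous fun η : Fin m → SpaceTime d => succDiff η k :=
      fun k => (continuous_apply k).sub ((continuous_apply _).comp
        (continuous_pi fun j => by
          refine Fin.cases ?_ (fun i => ?_) j
          · simpa using continuous_const
          · simpa using continuous_apply i))
    rw [htc]
    exact isOpen_iInter_of_finite fun k => isOpen_forwardCone.preimage (hs k)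
  exact interior_maximal hsub hopen ⟨η, hη, rfl⟩

/-- **Positive time-ordered configurations are admissible for the OS momentum set**: their
Euclidean points lie in the Laplace domain of `flatten '' osMomentumSet d m`. [folklore] -/
theorem timeOrderedRegion_subset_laplaceDomain_os :
    timeOrderedRegion d m ⊆ laplaceDomain (flattenCLE d m '' osMomentumSet d m) (euclidUncurry d m) := by
  intro x hx
  rw [mem_laplaceDomain_iff, imVec_euclidUncurry]
  exact flattenCLE_mem_interior_polarCone_osMomentumSet (smul_e₀_mem_tubeCone hx)

/-! ### Block structure of the spectral set -/

/-- Partial sums of a `Fin.cons`: the `0`-th. [folklore] -/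
theorem sum_Iic_cons_zero (a : SpaceTime d) (q : Fin m → SpaceTime d) :
    ∑ j ∈ Finset.Iic (0 : Fin (m + 1)), (Fin.cons a q : Fin (m + 1) → SpaceTime d) j = a := by
  rw [sum_Iic_eq_sum_ite, Fin.sum_univ_succ]
  simp [Fin.succ_ne_zero]

/-- Partial sums of a `Fin.cons`: the `(i+1)`-st is `a` plus the `i`-th partial sum of the tail.
[folklore] -/
theorem sum_Iic_cons_succ (a : SpaceTime d) (q : Fin m → SpaceTime d) (i : Fin m) :
    ∑ j ∈ Finset.Iic i.succ, (Fin.cons a q : Fin (m + 1) → SpaceTime d) j =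
      a + ∑ j ∈ Finset.Iic i, q j := by
  rw [sum_Iic_eq_sum_ite, sum_Iic_eq_sum_ite, Fin.sum_univ_succ]
  simp only [Fin.zero_le, if_true, Fin.cons_zero, Fin.cons_succ, Fin.succ_le_succ_iff]

/-- **The spectral set lies in the OS momentum set**: `q ∈ spectralSet d m` is the tail of
`(0, q) ∈ spectralSet d (m+1)`. [folklore] -/
theorem spectralSet_subset_osMomentumSet : spectralSet d m ⊆ osMomentumSet d m := by
  intro q hq
  refine ⟨Fin.cons 0 q, ⟨?_, fun k => ?_⟩, by funext i; simp⟩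
  · rw [Fin.sum_univ_succ]; simpa using hq.1
  · refine Fin.cases ?_ (fun i => ?_) k
    · rw [sum_Iic_cons_zero]; exact WightmanFamily.zero_mem_closedForwardCone d
    · rw [sum_Iic_cons_succ, zero_add]; exact hq.2 i

/-- A partial sum of a configuration of `n + m` points up to an index in the second block splits
into the full first block and a partial sum of the second block. [folklore] -/
theorem sum_Iic_natAdd (p : Fin (n + m) → SpaceTime d) (i : Fin m) :
    ∑ j ∈ Finset.Iic (Fin.natAdd n i), p j =
      ∑ j : Fin n, p (Fin.castAdd m j) + ∑ j ∈ Finset.Iic i, p (Fin.natAdd n j) := by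
  rw [sum_Iic_eq_sum_ite, sum_Iic_eq_sum_ite, Fin.sum_univ_add]
  congr 1
  · refine Finset.sum_congr rfl fun j _ => ?_
    rw [if_pos]
    rw [Fin.le_def]; simp only [Fin.val_castAdd, Fin.val_natAdd]; omega
  · refine Finset.sum_congr rfl fun j _ => ?_
    have : (Fin.natAdd n j ≤ Fin.natAdd n i) ↔ j ≤ i := by
      rw [Fin.le_def, Fin.le_def]; simp only [Fin.val_natAdd]; omega
    simp only [this]

/-- A partial sum up to an index in the first block is a partial sum of the first block. [folklore] -/
theorem sum_Iic_castAdd (p : Fin (n + m) → SpaceTime d) (i : Fin n) :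
    ∑ j ∈ Finset.Iic (Fin.castAdd m i), p j = ∑ j ∈ Finset.Iic i, p (Fin.castAdd m j) := by
  rw [sum_Iic_eq_sum_ite, sum_Iic_eq_sum_ite, Fin.sum_univ_add]
  have h2 : ∑ j : Fin m, (if Fin.natAdd n j ≤ Fin.castAdd m i then p (Fin.natAdd n j) else 0) = 0 := by
    refine Finset.sum_eq_zero fun j _ => ?_
    rw [if_neg]
    rw [Fin.le_def]; simp only [Fin.val_castAdd, Fin.val_natAdd]; omega
  rw [h2, add_zero]
  refine Finset.sum_congr rfl fun j _ => ?_
  have : (Fin.castAdd m j ≤ Fin.castAdd m i) ↔ j ≤ i := by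
    rw [Fin.le_def, Fin.le_def]; simp only [Fin.val_castAdd]
  simp only [this]

/-- **The second block of a point of the spectral set lies in the OS momentum set**: the momenta
of the `m` positive-time points of `𝔖ₙ₊ₘ(Θf* ⊗ g)` (OS I (1973), (4.24), the arguments
`(qₙ, …, q_{n+m−1})` of `g̃ₘ`). Lift: `(∑_{j<n} pⱼ, p_n, …, p_{n+m−1}) ∈ spectralSet d (m+1)`.
[cite: OsterwalderSchraderCMP1973, §4.3 eq. (4.24)] -/
theorem block_natAdd_mem_osMomentumSet {p : Fin (n + m) → SpaceTime d} (hp : p ∈ spectralSet d (n + m)) :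
    (fun i => p (Fin.natAdd n i)) ∈ osMomentumSet d m := by
  refine ⟨Fin.cons (∑ j : Fin n, p (Fin.castAdd m j)) (fun i => p (Fin.natAdd n i)), ⟨?_, fun k => ?_⟩,
    by funext i; simp⟩
  · rw [Fin.sum_univ_succ]
    simp only [Fin.cons_zero, Fin.cons_succ]
    rw [← Fin.sum_univ_add]; exact hp.1
  · refine Fin.cases ?_ (fun i => ?_) k
    · rw [sum_Iic_cons_zero]
      exact WightmanFamily.sum_castAdd_mem_closedForwardCone_of_mem_spectralSet d n m hp
    · rw [sum_Iic_cons_succ, ← sum_Iic_natAdd]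
      exact hp.2 _

/-- **The first block of a point of the spectral set, reversed and negated, lies in the OS momentum
set**: the momenta of the `n` reflected points of `𝔖ₙ₊ₘ(Θf* ⊗ g)` (OS I (1973), (4.24), the
arguments `(qₙ, −q_{n−1}, …, −q₁)` of `f̄̃ₙ`). Lift:
`(∑_{j<n} pⱼ, −p_{n−1}, …, −p₀) ∈ spectralSet d (n+1)`, whose partial sums are partial sums of `p`.
[cite: OsterwalderSchraderCMP1973, §4.3 eq. (4.24)] -/
theorem negRev_block_castAdd_mem_osMomentumSet {p : Fin (n + m) → SpaceTime d}
    (hp : p ∈ spectralSet d (n + m)) :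
    (fun i => -p (Fin.castAdd m (Fin.rev i))) ∈ osMomentumSet d n := by
  set a : SpaceTime d := ∑ j : Fin n, p (Fin.castAdd m j) with ha
  refine ⟨Fin.cons a (fun i => -p (Fin.castAdd m (Fin.rev i))), ⟨?_, fun k => ?_⟩, by funext i; simp⟩
  · rw [Fin.sum_univ_succ]
    simp only [Fin.cons_zero, Fin.cons_succ, Finset.sum_neg_distrib]
    rw [ha, ← Equiv.sum_comp Fin.revPerm (fun i => p (Fin.castAdd m i))]
    simp
  · refine Fin.cases ?_ (fun i => ?_) k
    · rw [sum_Iic_cons_zero]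
      exact WightmanFamily.sum_castAdd_mem_closedForwardCone_of_mem_spectralSet d n m hp
    · rw [sum_Iic_cons_succ]
      -- `a − ∑_{j ≤ i} p_{rev j} = ∑_{j' < n − 1 − i} p_{j'}`
      have hrev : ∑ j ∈ Finset.Iic i, -p (Fin.castAdd m (Fin.rev j)) =
          -∑ j' : Fin n, if i < Fin.rev j' then 0 else p (Fin.castAdd m j') := by
        rw [sum_Iic_eq_sum_ite, ← Finset.sum_neg_distrib,
          ← Equiv.sum_comp Fin.revPerm (fun j' : Fin n => -(if i < Fin.rev j' then (0 : SpaceTime d)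
            else p (Fin.castAdd m j')))]
        refine Finset.sum_congr rfl fun j _ => ?_
        simp only [Fin.revPerm_apply, Fin.rev_rev]
        by_cases hji : j ≤ i
        · rw [if_pos hji, if_neg (not_lt.2 hji)]
        · rw [if_neg hji, if_pos (not_le.1 hji), neg_zero]
      have hsplit : a = ∑ j' : Fin n, (if i < Fin.rev j' then p (Fin.castAdd m j') else 0) +
          ∑ j' : Fin n, (if i < Fin.rev j' then 0 else p (Fin.castAdd m j')) := by
        rw [ha, ← Finset.sum_add_distrib]
        refine Finset.sum_congr rfl fun j' _ => ?_
        split_ifs <;> simp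
      rw [hrev, hsplit, add_neg_cancel_right]
      -- the remaining sum is a partial sum of `p` (or empty)
      by_cases hi : (i : ℕ) + 1 < n
      · have hlt : n - 2 - (i : ℕ) < n := by omega
        set k' : Fin n := ⟨n - 2 - i, hlt⟩ with hk'
        have hk := hp.2 (Fin.castAdd m k')
        rw [sum_Iic_castAdd, sum_Iic_eq_sum_ite] at hk
        convert hk using 2 with j' _
        have : (i < Fin.rev j') ↔ j' ≤ k' := by
          rw [Fin.lt_def, Fin.le_def, Fin.val_rev, hk']
          simp only
          omega
        simp only [this]
      · have h0 : ∑ j' : Fin n, (if i < Fin.rev j' then p (Fin.castAdd m j') else 0) = 0 := by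
          refine Finset.sum_eq_zero fun j' _ => ?_
          rw [if_neg]
          rw [Fin.lt_def, Fin.val_rev]
          omega
        rw [h0]
        exact WightmanFamily.zero_mem_closedForwardCone d

end Literature.MathematicalPhysics.QuantumFieldTheory

namespace Literature.MathematicalPhysics.QuantumFieldTheory

variable {d n m : ℕ}

/-! ### The exponent of the Laplace kernel at Euclidean points -/

/-- **The exponent at a Euclidean point**:
`expForm (euclidUncurry x) (flatten ξ) = −2πi ∑ₖ (i x⁰ₖ ξ⁰ₖ + ∑_μ x^μ_k ξ^μ_k)
= 2π ∑ₖ x⁰ₖ ξ⁰ₖ − 2πi ∑ₖ ⟪x⃗ₖ, ξ⃗ₖ⟫` (OS I (1973), (4.20), the kernel `e^{−∑(ξ⁰q⁰ + i ξ⃗q⃗)}` in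
the tree's `2π` normalisation and sign convention). [cite: OsterwalderSchraderCMP1973, §4.3 eq. (4.20)] -/
theorem expForm_euclidUncurry (x ξ : Fin n → SpaceTime d) :
    expForm (euclidUncurry d n x) (flattenCLE d n ξ) =
      -(2 * Real.pi * I) * ∑ k, (I * (x k 0 : ℂ) * (ξ k 0 : ℂ) +
        ∑ μ : Fin d, (x k μ.succ : ℂ) * (ξ k μ.succ : ℂ)) := by
  rw [expForm_apply, Fintype.sum_prod_type]
  congr 1
  refine Finset.sum_congr rfl fun k _ => ?_
  rw [Fin.sum_univ_succ]
  simp [flattenCLE_apply]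

/-- **Appending blocks adds the exponents**: for `x ∈ (ℝ^{d+1})ⁿ`, `y ∈ (ℝ^{d+1})ᵐ` and
`ξ ∈ (ℝ^{1+d})^{n+m}`, the exponent at the appended configuration is the sum of the exponents of
the blocks against the corresponding blocks of `ξ`. [folklore] -/
theorem expForm_euclidUncurry_append (x : Fin n → SpaceTime d) (y : Fin m → SpaceTime d)
    (ξ : Fin (n + m) → SpaceTime d) :
    expForm (euclidUncurry d (n + m) (Fin.append x y)) (flattenCLE d (n + m) ξ) =
      expForm (euclidUncurry d n x) (flattenCLE d n fun k => ξ (Fin.castAdd m k)) +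
        expForm (euclidUncurry d m y) (flattenCLE d m fun k => ξ (Fin.natAdd n k)) := by
  simp only [expForm_euclidUncurry, Fin.sum_univ_add, Fin.append_left, Fin.append_right, mul_add]

variable (d n) in
/-- The reflection `ξ ↦ (−ξ_{n−1}, …, −ξ₀)` of momentum configurations (the change of variables
`(qₙ, −q_{n−1}, …, −q₁)` of OS I (1973), (4.24)), a continuous linear automorphism.
[cite: OsterwalderSchraderCMP1973, §4.3 eq. (4.24)] -/
def negRevConfig : (Fin n → SpaceTime d) ≃L[ℝ] (Fin n → SpaceTime d) :=
  ((LinearEquiv.funCongrLeft ℝ (SpaceTime d) (Fin.revPerm : Fin n ≃ Fin n)).trans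
    (LinearEquiv.neg ℝ)).toContinuousLinearEquiv

/-- Components of `negRevConfig`. [folklore] -/
@[simp]
theorem negRevConfig_apply (ξ : Fin n → SpaceTime d) (k : Fin n) :
    negRevConfig d n ξ k = -ξ (Fin.rev k) := rfl

/-- `negRevConfig` is an involution. [folklore] -/
@[simp]
theorem negRevConfig_negRevConfig (ξ : Fin n → SpaceTime d) :
    negRevConfig d n (negRevConfig d n ξ) = ξ := by
  funext k; simp

/-- **The exponent at an OS-reflected configuration**: for the reflected, reversed configuration
`(θx_{n−1}, …, θx₀)` the exponent against `ξ` is the complex conjugate of the exponent of `x`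
against `(−ξ_{n−1}, …, −ξ₀)` (`θ` flips the sign of the imaginary time coordinate, i.e. conjugates
the Euclidean point). [folklore] -/
theorem expForm_euclidUncurry_thetaRev [NeZero d] (x ξ : Fin n → SpaceTime d) :
    expForm (euclidUncurry d n fun k => timeReflection (d + 1) (x (Fin.rev k))) (flattenCLE d n ξ) =
      conj (expForm (euclidUncurry d n x) (flattenCLE d n (negRevConfig d n ξ))) := by
  rw [expForm_euclidUncurry, expForm_euclidUncurry]
  set c : ℂ := -(2 * Real.pi * I) with hcdef
  have hc : conj c = -c := by
    rw [hcdef]; simp [Complex.conj_ofReal, map_ofNat]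
  clear_value c
  rw [map_mul, hc, map_sum, neg_mul, ← mul_neg, ← Finset.sum_neg_distrib]
  refine congrArg (fun S : ℂ => c * S) (Fintype.sum_equiv (Fin.revPerm : Fin n ≃ Fin n) _ _ fun k => ?_)
  simp only [Fin.revPerm_apply, timeReflection_apply, if_true, Fin.succ_ne_zero, if_false,
    negRevConfig_apply, Fin.rev_rev, PiLp.neg_apply, map_add, map_neg, map_mul, map_sum,
    Complex.conj_I, Complex.conj_ofReal, Complex.ofReal_neg, mul_neg, Finset.sum_neg_distrib]
  ring

/-- For a purely spatial vector `a`, the Euclidean point of the constant configuration `(a, …, a)`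
is real: it is the flattened configuration coerced to `ℂ`. [folklore] -/
theorem euclidUncurry_const_of_spatial {a : SpaceTime d} (ha : a 0 = 0) :
    euclidUncurry d n (fun _ => a) = fun i => ((flattenCLE d n (fun _ : Fin n => a)) i : ℂ) := by
  funext i
  rcases i with ⟨k, μ⟩
  by_cases hμ : μ = 0
  · subst hμ; simp [euclideanPoint, ha]
  · simp [euclideanPoint, hμ]

/-- **Spatial translations give the Fourier phase**: for `a⁰ = 0` the exponent of the constant
configuration `(a, …, a)` is `−2πi⟪ã, ξ̃⟫` with `ã = flatten (a, …, a)`. [folklore] -/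
theorem expForm_euclidUncurry_const_of_spatial {a : SpaceTime d} (ha : a 0 = 0)
    (ξ : Fin n → SpaceTime d) :
    expForm (euclidUncurry d n fun _ => a) (flattenCLE d n ξ) =
      ((-2 * Real.pi * ⟪flattenCLE d n (fun _ : Fin n => a), flattenCLE d n ξ⟫ : ℝ) : ℂ) * I := by
  rw [euclidUncurry_const_of_spatial ha, expForm_ofReal_apply]

/-- **Time translations give a real exponential factor**: the exponent of the constant
configuration `(t ê₀, …, t ê₀)` is `2πt ∑ₖ ξ⁰ₖ`. [folklore] -/
theorem expForm_euclidUncurry_const_single (t : ℝ) (ξ : Fin n → SpaceTime d) :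
    expForm (euclidUncurry d n fun _ => EuclideanSpace.single (0 : Fin (d + 1)) t) (flattenCLE d n ξ) =
      ((2 * Real.pi * t * ∑ k, ξ k 0 : ℝ) : ℂ) := by
  rw [expForm_euclidUncurry]
  have h0 : ∀ k : Fin n, (I * ((EuclideanSpace.single (0 : Fin (d + 1)) t : SpaceTime d) 0 : ℂ) * (ξ k 0 : ℂ) +
      ∑ μ : Fin d, (((EuclideanSpace.single (0 : Fin (d + 1)) t : SpaceTime d) μ.succ : ℂ)) * (ξ k μ.succ : ℂ))
      = I * t * (ξ k 0 : ℂ) := fun k => by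
    simp [Fin.succ_ne_zero]
  simp only [h0, ← Finset.mul_sum]
  push_cast
  linear_combination (-(2 * (Real.pi : ℂ) * (t : ℂ) * ∑ k, ((ξ k 0 : ℝ) : ℂ))) * Complex.I_mul_I

/-- Translating a configuration adds the exponent of the constant configuration. [folklore] -/
theorem expForm_euclidUncurry_add_const (x : Fin n → SpaceTime d) (a : SpaceTime d)
    (ξ : EuclideanSpace ℝ (Fin n × Fin (d + 1))) :
    expForm (euclidUncurry d n fun k => x k + a) ξ =
      expForm (euclidUncurry d n x) ξ + expForm (euclidUncurry d n fun _ => a) ξ := by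
  have : (fun k => x k + a) = x + fun _ => a := rfl
  rw [this, map_add, expForm_add]
  rfl

/-! ### Splitting integrals over appended configurations -/

section Append

variable (n m) in
/-- The measurable equivalence `(Eⁿ × Eᵐ) ≃ E^{n+m}` given by `Fin.append`. [folklore] -/
def appendMeasurableEquiv (E : Type*) [MeasurableSpace E] :
    ((Fin n → E) × (Fin m → E)) ≃ᵐ (Fin (n + m) → E) :=
  (MeasurableEquiv.sumPiEquivProdPi (fun _ : Fin n ⊕ Fin m => E)).symm.trans
    (MeasurableEquiv.piCongrLeft (fun _ : Fin (n + m) => E) finSumFinEquiv)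

/-- `appendMeasurableEquiv (x, y) = Fin.append x y`. [folklore] -/
theorem appendMeasurableEquiv_apply {E : Type*} [MeasurableSpace E] (q : (Fin n → E) × (Fin m → E)) :
    appendMeasurableEquiv n m E q = Fin.append q.1 q.2 := by
  have key : ∀ b : Fin n ⊕ Fin m, appendMeasurableEquiv n m E q (finSumFinEquiv b) = Sum.elim q.1 q.2 b := by
    intro b
    simp only [appendMeasurableEquiv, MeasurableEquiv.trans_apply, MeasurableEquiv.coe_piCongrLeft,
      MeasurableEquiv.coe_sumPiEquivProdPi_symm]
    rw [Equiv.piCongrLeft_apply_apply]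
    cases b <;> rfl
  funext i
  obtain ⟨b, rfl⟩ := finSumFinEquiv.surjective i
  rw [key]
  cases b with
  | inl j => simp
  | inr j => simp

/-- `Fin.append` is measure preserving from the product of the product measures. [folklore] -/
theorem measurePreserving_appendMeasurableEquiv (E : Type*) [MeasureSpace E]
    [SigmaFinite (volume : Measure E)] :
    MeasurePreserving (appendMeasurableEquiv n m E) volume volume :=
  (volume_measurePreserving_piCongrLeft (fun _ : Fin (n + m) => E) finSumFinEquiv).comp
    (volume_measurePreserving_sumPiEquivProdPi_symm (fun _ : Fin n ⊕ Fin m => E))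

/-- **Splitting an integral of a product over appended configurations** (Fubini along
`E^{n+m} ≃ Eⁿ × Eᵐ`): `∫ φ(z|₁) ψ(z|₂) dz = (∫ φ) (∫ ψ)` — no integrability hypotheses (both sides
are `0` in the non-integrable cases, `integral_prod_mul`). [folklore] -/
theorem integral_fin_append_mul {E : Type*} [MeasureSpace E] [SigmaFinite (volume : Measure E)]
    (φ : (Fin n → E) → ℂ) (ψ : (Fin m → E) → ℂ) :
    ∫ z : Fin (n + m) → E, φ (fun i => z (Fin.castAdd m i)) * ψ (fun j => z (Fin.natAdd n j)) =
      (∫ x, φ x) * ∫ y, ψ y := by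
  have h := (measurePreserving_appendMeasurableEquiv (n := n) (m := m) E).integral_comp
    (appendMeasurableEquiv n m E).measurableEmbedding
    (fun z : Fin (n + m) → E => φ (fun i => z (Fin.castAdd m i)) * ψ (fun j => z (Fin.natAdd n j)))
  rw [← h]
  simp only [appendMeasurableEquiv_apply, Fin.append_left, Fin.append_right]
  rw [Measure.volume_eq_prod]
  exact integral_prod_mul φ ψ

end Append

end Literature.MathematicalPhysics.QuantumFieldTheory
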